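import Mathlib.NumberTheory.Padics.Complex
import Literature.AlgebraicGeometry.Frobenioids.QuasiTemperoidGaloisFields
import Literature.AlgebraicGeometry.Frobenioids.PadicFrobenioidQp
import HarnessLib

/-!
# Frobenioids II, Example 1.3 (iii) / Example 1.1 (ii): the base functor `B^temp(G_{ℚ_p})⁰ → D₀` into
# `p`-adic VALUED fields — the input of Theorem 1.2 for the bases `B^temp(Π, Π°)⁰`

Mochizuki, *The geometry of Frobenioids II*, Kyushu J. Math. **62** (2008) 401–460, §1, Example 1.3 (iii),
p. 12 [cite: MochizukiFrdII2008, Ex 1.3 (iii) pp.11-12]: "when `F = ℚ_p`, if we set `D := B^temp(Π, Π°)⁰`,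
then we obtain a functor `D → D₀ = B^temp(G_{ℚ_p})⁰` [cf. Example 1.1, (ii)] which satisfies the hypotheses of
Theorem 1.2, (i)"; Example 1.1 (i) p. 7 [cite: MochizukiFrdII2008, Ex 1.1 (i) p.7]: the objects `Spec K` of
`D₀`, "[i.e., `K` is a finite extension of `ℚ_p`]", carry "the ring of integers `O_K`" — the valuation.

Sequel to `QuasiTemperoidGaloisFields.lean` (the Galois-correspondence functor
`QuasiTemperoid.galoisFields F : B^temp(G_F)⁰ ⥤ FinEtale F`). The tree's Theorem 1.2 (`PadicFrd.Datum`,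
`PadicFrobenioid.lean`) binds its base as a functor `base : D ⥤ PadicFrd.PadicFld p` into VALUED fields
satisfying `IsPadicLocal` ("finite over `ℚ_p` with the `p`-adic valuation"). This file lifts the Galois
correspondence to that target:

* `subfieldValuativeRel` — the valuative relation on an intermediate field `K` of `ℚ̄_p/ℚ_p`
  (`ℚ̄_p = PadicAlgCl p = AlgebraicClosure ℚ_[p]`, Mathlib, valued by the spectral norm): the restriction of
  the `p`-adic valuation of `ℚ̄_p`; it extends the valuative relation of `ℚ_p` (`subfield_valuativeExtension`,
  via `padic_vle_iff_norm_le`), so `padicFldOf K : PadicFld p` (through the tree's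
  `PadicFrd.ofFiniteExtension`) and, for `K` finite, `IsPadicLocal` (`isPadicLocal_padicFldOf`);
* Galois automorphisms are isometries of the spectral norm (Mathlib `spectralNorm_eq_of_equiv`), so the
  field maps `a ↦ g·a` of `galoisFields` are VALUATIVE (`isValHom_restrictBetween`);
* `QuasiTemperoid.galoisPadicFields p : ConnectedPart (BTemp (Field.absoluteGaloisGroup ℚ_[p])) ⥤
  PadicFrd.PadicFld p` — the lift (same objects and field maps as `galoisFields ℚ_[p]`,
  `galoisPadicFields_obj_K`, `galoisPadicFields_map_alg`), every value `IsPadicLocal`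
  (`isPadicLocal_galoisPadicFields`), faithful (`galoisPadicFields_faithful`).

Hence the printed composite of Example 1.3 (iii) followed by `galoisPadicFields p` is a base
`B^temp(Π, Π°)⁰ ⥤ PadicFld p` with `IsPadicLocal` values, as `PadicFrd.Datum` demands. Classical
(`p`-adic analysis over Mathlib); no statement of the paper is strengthened; nothing here bears on [IUTchIII].
-/

namespace Literature.AlgebraicGeometry.Frobenioids

namespace QuasiTemperoid

open CategoryTheory Topology ValuativeRel
open Literature.AnabelianGeometry.SemiGraphs

variable (p : ℕ) [Fact p.Prime]

/-! ### The valuative relation of `ℚ_p` is the order of the norm -/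

/-- In `ℚ_p`, `a ≤ᵥ b` iff `‖a‖ ≤ ‖b‖` (Mathlib's valuative relation on `ℚ_[p]` is that of
`Padic.mulValuation = exp(−v_p)`, and `‖x‖ = p^{−v_p(x)}`). [cite: MochizukiFrdII2008, Ex 1.1 (i) p.7] -/
theorem padic_vle_iff_norm_le (a b : ℚ_[p]) : a ≤ᵥ b ↔ ‖a‖ ≤ ‖b‖ := by
  rw [(Padic.mulValuation (p := p)).vle_iff_le]
  have hp : 1 < (p : ℝ) := by exact_mod_cast (Fact.out : p.Prime).one_lt
  by_cases ha : a = 0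
  · subst ha; simp
  by_cases hb : b = 0
  · subst hb
    simp only [map_zero, le_zero_iff, norm_zero]
    constructor
    · intro h; exact absurd h ((Padic.mulValuation (p := p)).ne_zero_iff.mpr ha)
    · intro h; exact absurd (le_antisymm h (norm_nonneg a)) (norm_ne_zero_iff.mpr ha)
  rw [PadicFrd.mulValuation_of_ne_zero p ha, PadicFrd.mulValuation_of_ne_zero p hb, WithZero.exp_le_exp,
    Padic.norm_eq_zpow_neg_valuation ha, Padic.norm_eq_zpow_neg_valuation hb, zpow_le_zpow_iff_right₀ hp]

/-! ### Intermediate fields of `ℚ̄_p / ℚ_p` as `p`-adic valued fields -/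

/-- The `p`-adic valuation of an intermediate field `K ⊆ ℚ̄_p`: the restriction of the spectral-norm
valuation of `ℚ̄_p = PadicAlgCl p` ("the ring of integers `O_K`", FrdII Ex. 1.1 (i) p. 7).
[cite: MochizukiFrdII2008, Ex 1.1 (i) p.7] -/
noncomputable def subfieldValuation (K : IntermediateField ℚ_[p] (Fbar ℚ_[p])) : Valuation K NNReal :=
  (Valued.v : Valuation (PadicAlgCl p) NNReal).comap (algebraMap K (PadicAlgCl p))

/-- Its value at `a` is the norm of `a` in `ℚ̄_p`. [cite: MochizukiFrdII2008, Ex 1.1 (i) p.7] -/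
theorem subfieldValuation_apply (K : IntermediateField ℚ_[p] (Fbar ℚ_[p])) (a : K) :
    subfieldValuation p K a = ‖(a : PadicAlgCl p)‖₊ := rfl

/-- The valuative relation of `K ⊆ ℚ̄_p` (not an instance: used through `letI`).
[cite: MochizukiFrdII2008, Ex 1.1 (i) p.7] -/
noncomputable abbrev subfieldValuativeRel (K : IntermediateField ℚ_[p] (Fbar ℚ_[p])) : ValuativeRel K :=
  ValuativeRel.ofValuation (subfieldValuation p K)

/-- Unfolded: `a ≤ᵥ b` in `K` iff `‖a‖ ≤ ‖b‖` in `ℚ̄_p`. [cite: MochizukiFrdII2008, Ex 1.1 (i) p.7] -/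
theorem subfield_vle_iff (K : IntermediateField ℚ_[p] (Fbar ℚ_[p])) (a b : K) :
    (letI := subfieldValuativeRel p K; a ≤ᵥ b) ↔ ‖(a : PadicAlgCl p)‖ ≤ ‖(b : PadicAlgCl p)‖ := by
  change subfieldValuation p K a ≤ subfieldValuation p K b ↔ _
  rw [subfieldValuation_apply, subfieldValuation_apply, ← NNReal.coe_le_coe, coe_nnnorm, coe_nnnorm]

/-- The valuative relation of `K` EXTENDS that of `ℚ_p` (the spectral norm extends the `p`-adic norm,
Mathlib `PadicAlgCl.norm_extends`). [cite: MochizukiFrdII2008, Ex 1.1 (i) p.7] -/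
theorem subfield_valuativeExtension (K : IntermediateField ℚ_[p] (Fbar ℚ_[p])) :
    letI := subfieldValuativeRel p K; ValuativeExtension ℚ_[p] K := by
  letI := subfieldValuativeRel p K
  refine ⟨fun a b => ?_⟩
  rw [subfield_vle_iff, padic_vle_iff_norm_le]
  have ha : ((algebraMap ℚ_[p] K a : K) : PadicAlgCl p) = (a : PadicAlgCl p) :=
    (IsScalarTower.algebraMap_apply ℚ_[p] K (PadicAlgCl p) a).symm
  have hb : ((algebraMap ℚ_[p] K b : K) : PadicAlgCl p) = (b : PadicAlgCl p) :=
    (IsScalarTower.algebraMap_apply ℚ_[p] K (PadicAlgCl p) b).symm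
  rw [ha, hb, PadicAlgCl.norm_extends, PadicAlgCl.norm_extends]

/-- **`Spec K ∈ Ob(D₀)` for `K ⊆ ℚ̄_p` an intermediate field**: the object of `PadicFld p` (the tree's
`PadicFrd.ofFiniteExtension`: `p ∈ O_K^⊳`, `v(p) < 1`). [cite: MochizukiFrdII2008, Ex 1.1 (i) p.7] -/
noncomputable def padicFldOf (K : IntermediateField ℚ_[p] (Fbar ℚ_[p])) : PadicFrd.PadicFld.{0} p :=
  letI := subfieldValuativeRel p K
  haveI := subfield_valuativeExtension p K
  PadicFrd.ofFiniteExtension p K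

/-- Its field is `K`. [cite: MochizukiFrdII2008, Ex 1.1 (i) p.7] -/
theorem padicFldOf_K (K : IntermediateField ℚ_[p] (Fbar ℚ_[p])) : (padicFldOf p K).K = ↥K := rfl

/-- For `K` finite over `ℚ_p`, `Spec K` satisfies the standing hypothesis `IsPadicLocal` ("[i.e., `K` is a
finite extension of `ℚ_p`]", FrdII p. 7). [cite: MochizukiFrdII2008, Ex 1.1 (i) p.7] -/
theorem isPadicLocal_padicFldOf (K : IntermediateField ℚ_[p] (Fbar ℚ_[p])) [FiniteDimensional ℚ_[p] K] :
    (padicFldOf p K).IsPadicLocal :=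
  letI := subfieldValuativeRel p K
  haveI := subfield_valuativeExtension p K
  PadicFrd.isPadicLocal_ofFiniteExtension p K

/-- **Galois automorphisms are isometries** (Mathlib `spectralNorm_eq_of_equiv`; the norm of `ℚ̄_p` IS the
spectral norm): the restriction `a ↦ g·a` between intermediate fields is a VALUATIVE ring homomorphism.
[cite: MochizukiFrdII2008, Ex 1.1 (i) p.7] -/
theorem isValHom_restrictBetween (g : GalFbar ℚ_[p]) (K₁ K₂ : IntermediateField ℚ_[p] (Fbar ℚ_[p]))
    (h : ∀ a ∈ K₁, g a ∈ K₂) :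
    letI := subfieldValuativeRel p K₁; letI := subfieldValuativeRel p K₂
    PadicFrd.IsValHom (restrictBetween g K₁ K₂ h).toRingHom := by
  letI := subfieldValuativeRel p K₁; letI := subfieldValuativeRel p K₂
  intro a b
  rw [subfield_vle_iff, subfield_vle_iff]
  change ‖(g (a : PadicAlgCl p) : PadicAlgCl p)‖ ≤ ‖g (b : PadicAlgCl p)‖ ↔ _
  rw [← PadicAlgCl.spectralNorm_eq, ← PadicAlgCl.spectralNorm_eq, ← spectralNorm_eq_of_equiv,
    ← spectralNorm_eq_of_equiv, PadicAlgCl.spectralNorm_eq, PadicAlgCl.spectralNorm_eq]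

/-! ### The lift `B^temp(G_{ℚ_p})⁰ → PadicFld p` -/

/-- The field map of `galoisPadicFields p` over `f : X → Y`: the valuative ring homomorphism
`ℚ̄_p^{Stab(x_Y)} → ℚ̄_p^{Stab(x_X)}`, `a ↦ g_f·a`. [cite: MochizukiFrdII2008, Ex 1.3 (iii) pp.11-12] -/
noncomputable def padicFieldHom {X Y : ConnectedPart (BTemp (GalFbar ℚ_[p]))} (f : X ⟶ Y) :
    padicFldOf p (fixFld ℚ_[p] X) ⟶ padicFldOf p (fixFld ℚ_[p] Y) :=
  ⟨(fieldMap f).toRingHom,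
    isValHom_restrictBetween p (carrier f) _ _ fun _ ha => apply_mem_fixFld f (carrier_spec f) ha⟩

/-- Its underlying ring homomorphism is that of `fieldMap f`. [cite: MochizukiFrdII2008, Ex 1.3 (iii) pp.11-12] -/
theorem padicFieldHom_alg {X Y : ConnectedPart (BTemp (GalFbar ℚ_[p]))} (f : X ⟶ Y) :
    (padicFieldHom p f).alg = (fieldMap f).toRingHom := rfl

/-- **FrdII Example 1.3 (iii) "[cf. Example 1.1, (ii)]", VALUED form — the functor
`B^temp(G_{ℚ_p})⁰ → D₀ = PadicFld p`**: a connected continuous `G_{ℚ_p}`-set `X` goes to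
`Spec ℚ̄_p^{Stab(x_X)}` with its `p`-adic valuation, a `G_{ℚ_p}`-map to the valuative field map `a ↦ g_f·a`.
[cite: MochizukiFrdII2008, Ex 1.3 (iii) pp.11-12] -/
noncomputable def galoisPadicFields : ConnectedPart (BTemp (GalFbar ℚ_[p])) ⥤ PadicFrd.PadicFld.{0} p where
  obj X := padicFldOf p (fixFld ℚ_[p] X)
  map f := padicFieldHom p f
  map_id X := PadicFrd.PadicFld.hom_ext (RingHom.ext fun a => Subtype.ext (fieldMap_id_apply X a))
  map_comp f h := PadicFrd.PadicFld.hom_ext (RingHom.ext fun a => Subtype.ext (fieldMap_comp_apply f h a).symm)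

/-- The field of `galoisPadicFields p X` is `ℚ̄_p^{Stab(x_X)}` — the same as that of `galoisFields ℚ_[p] X`.
[cite: MochizukiFrdII2008, Ex 1.3 (iii) pp.11-12] -/
theorem galoisPadicFields_obj_K (X : ConnectedPart (BTemp (GalFbar ℚ_[p]))) :
    ((galoisPadicFields p).obj X).K = ↥(fixFld ℚ_[p] X) := rfl

/-- … and its field maps are those of `galoisFields ℚ_[p]`. [cite: MochizukiFrdII2008, Ex 1.3 (iii) pp.11-12] -/
theorem galoisPadicFields_map_alg {X Y : ConnectedPart (BTemp (GalFbar ℚ_[p]))} (f : X ⟶ Y) :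
    ((galoisPadicFields p).map f).alg = (((galoisFields ℚ_[p]).map f).alg).toRingHom := rfl

/-- **Every value is a `p`-adic local field** (`IsPadicLocal`: finite over `ℚ_p` with THE extension of the
`p`-adic valuation) — the standing hypothesis of FrdII Theorem 1.2 on the objects of the base ("which
satisfies the hypotheses of Theorem 1.2, (i)", Ex. 1.3 (iii) p. 12). [cite: MochizukiFrdII2008, Ex 1.3 (iii) pp.11-12] -/
theorem isPadicLocal_galoisPadicFields (X : ConnectedPart (BTemp (GalFbar ℚ_[p]))) :
    ((galoisPadicFields p).obj X).IsPadicLocal :=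
  haveI := finiteDimensional_fixFld ℚ_[p] X
  isPadicLocal_padicFldOf p (fixFld ℚ_[p] X)

/-- `galoisPadicFields p` is faithful (as `galoisFields ℚ_[p]` is: same field maps).
[cite: MochizukiFrdII2008, Ex 1.3 (iii) pp.11-12] -/
theorem galoisPadicFields_faithful : (galoisPadicFields p).Faithful := by
  refine ⟨fun {X Y} f f' hff' => (galoisFields_faithful ℚ_[p]).map_injective ?_⟩
  apply FinEtale.hom_ext
  apply AlgHom.ext
  intro a
  have h := congrArg (fun φ : (galoisPadicFields p).obj X ⟶ (galoisPadicFields p).obj Y => φ.alg a) hff'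
  exact h

end QuasiTemperoid

end Literature.AlgebraicGeometry.Frobenioids
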